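import Summits.CriticalPhenomena.PercolationContinuityZ3.Theorems.PercNearOneGluingAdditiveGluingSepCaptureAux
import Mathlib.Combinatorics.SetFamily.FourFunctions
import HarnessLib

/-!
# Crux `PercNearOneGluing.AdditiveGluing` (stmt-CriticalPhenomena-4576) — the SEPARATED-CAPTURE
# inequality for three terminals with two avoidance sets (a new vdBK/BHK-type correlation inequality)

Helper file (task `png-dp-al5`, gen 3; `--supports stmt-CriticalPhenomena-4576`), part B of two (part A =
`…SepCaptureAux.lean`: restriction lemmas and the conditioning identity).  Bond percolation with
arbitrary edge probabilities on a finite vertex type (`μ = prodBernoulli w`), three vertices `o, a, b` and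
vertex sets `S, T`.  Write `{o,a,b} ↮ W` for "no vertex of `W` is joined to `o`, `a` or `b`".  Then

  `μ(o↔a, o↮b, a↮b, {o,a,b}↮S) · μ(o↔b, o↮a, a↮b, {o,a,b}↮T)`
  `   ≤ μ(o↔a, o↔b, {o,a,b}↮(S∩T)) · μ(o↮a, o↮b, a↮b, {o,a,b}↮(S∪T))`            (sepCapture)

(`sepCapture_two_sets`).  With `S = T = {c}` this is the four-point partition inequality

  `P(oa|b|c) · P(ob|a|c) ≤ P(oab|c) · P(o|a|b|c)`                                        (V1)

(`sepCapture_three`; blocks of the partition of `{o,a,b,c}` induced by the open clusters), the "fully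
separated" sharpening of the captured-set inequality `P(S={a})P(S={b}) ≤ P(S={a,b})P(S=∅)` of
`Literature/Probability/Percolation/TwoAvoidanceSets.lean` (`capturedSet_mul_le`, BHK 2006 Thm. 1.1): the
third relay `c` is kept ISOLATED on the right-hand side too.  It is not an instance of the Harris /
Ahlswede–Daykin four-event inequality (the join of two configurations in which `c` is isolated need not
isolate `c`), nor of BHK's Thms. 1.1/1.5 (the events are not measurable with respect to one or two clusters);
numerically it is one of the few "dilution-free" quadratic relations among the four-terminal partition
probabilities (memo R3-REALIZABILITY.md of the item).

## Proof (van den Berg–Kahn 2001, method of Thm. 1.2; BHK 2006 pp. 3–5)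

Exactly the induction of [VandenbergKahn2001] / [VandenbergHaggstromKahn2005, Thm. 1.1] as formalised in
`ConditionalPositiveAssociationProofs.lean` (`BHK2006.core`), for percolation restricted to a vertex set `U`:
if `Z := S ∩ T = ∅` the inequality (with `μ(o↔a, o↔b)` unrestricted on the right) is the Ahlswede–Daykin four
functions theorem on the configuration lattice (`{o↔a}`, `{o↔b}` are up-sets; `{o↮b, a↮b, {o,a,b}↮S}`,
`{o↮a, a↮b, {o,a,b}↮T}` are down-sets whose intersection is the fully separated event); if `Z ≠ ∅`,
condition on the random set `R` of vertices of `U ∖ Z` joined to `Z` by an open edge: on `{o,a,b} ↮ Z` every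
event above is the corresponding event of `G[U ∖ Z]` with `Z` replaced by `R` (BHK's identity (6), here
for the three sources `o, a, b` at once), the law of `R` is a product weight, and the four functions
theorem with the induction hypothesis for `G[U ∖ Z]` (sets `(S∖Z) ∪ R`, `(T∖Z) ∪ R'`, whose intersection
contains `R ∩ R'` and whose union is `(S∪T)∖Z ∪ (R ∪ R')`) closes the induction.

## References
* J. van den Berg, J. Kahn, *A correlation inequality for connection events in percolation*, Ann. Probab.
  29 (2001) 123–126, Thm. 1.2 and its proof (pp. 124–126). [VandenbergKahn2001]
* J. van den Berg, O. Häggström, J. Kahn, RSA 29 (2006) 417–435, Thm. 1.1 (pp. 3–5). [VandenbergHaggstromKahn2005]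
* R. Ahlswede, D. E. Daykin, Z. Wahrsch. Verw. Gebiete 43 (1978) 183–185 (Mathlib `four_functions_theorem_univ`).
-/

noncomputable section

open MeasureTheory
open Literature.Probability.LatticeModels (prodBernoulli)
open Literature.Probability.Percolation
open Literature.Probability.Percolation.BHK2006
open DecisionTree (ind ind_of_mem ind_of_not_mem ind_nonneg)

namespace Summit.CriticalPhenomena.PercolationContinuityZ3.Theorems

open scoped Classical

variable {V : Type*}

/-! Local notations (no new definitions): `rR[U, x, y]` = `{x ↔ y in G[U]}`; `rAV[U, o, a, b, W]` =
`{o ↮ W} ∩ {a ↮ W} ∩ {b ↮ W}` in `G[U]` (BHK's `R_W` for the three sources). -/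
local notation3 "rR[" U ", " x ", " y "]" =>
  {ω : Set (Sym2 V) | (openGraph (ω ∩ edgesIn U)).Reachable x y}
local notation3 "rAV[" U ", " o ", " a ", " b ", " W "]" => rD U o W ∩ rD U a W ∩ rD U b W

section Events

/-! `E1[U, o, a, b, W]` = `{o↔a, o↮b, a↮b, {o,a,b}↮W}` ("`o` captures exactly `a`, everything else
separated"), `EJ` = `{o↔a, o↔b, {o,a,b}↮W}`, `ES` = `{o↮a, o↮b, a↮b, {o,a,b}↮W}` in `G[U]`. -/
local notation3 "E1[" U ", " o ", " a ", " b ", " W "]" =>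
  rR[U, o, a] ∩ (rR[U, o, b])ᶜ ∩ (rR[U, a, b])ᶜ ∩ rAV[U, o, a, b, W]
local notation3 "EJ[" U ", " o ", " a ", " b ", " W "]" =>
  rR[U, o, a] ∩ rR[U, o, b] ∩ rAV[U, o, a, b, W]
local notation3 "ES[" U ", " o ", " a ", " b ", " W "]" =>
  (rR[U, o, a])ᶜ ∩ (rR[U, o, b])ᶜ ∩ (rR[U, a, b])ᶜ ∩ rAV[U, o, a, b, W]

variable [Fintype V]

/-! ### The induction (van den Berg–Kahn 2001 / BHK 2006, Thm. 1.1, for the three-terminal events) -/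

/-- **Separated capture, restricted to `G[U]`, two avoidance sets.**  For all `o, a, b` and
`S, T ⊆ U`:
`μ(E1[U,o,a,b,S]) · μ(E1[U,o,b,a,T]) ≤ μ(EJ[U,o,a,b,S ∩ T]) · μ(ES[U,o,a,b,S ∪ T])`
(weight sums).  Proof by strong induction on `U`, word for word as `BHK2006.core`.
[cite: VandenbergKahn2001, Thm. 1.2 (pp. 124–126) — method; derived in this file] -/
theorem sepCapture_core (w : Sym2 V → ℝ) (hw0 : ∀ e, 0 ≤ w e) (hw1 : ∀ e, w e ≤ 1)
    (hm : ∑ ω, weight w ω = 1) (U : Finset V) :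
    ∀ (o a b : V) (S T : Set V), S ⊆ ↑U → T ⊆ ↑U →
    (∑ ω, weight w ω * ind (E1[U, o, a, b, S]) ω) *
      (∑ ω, weight w ω * ind (E1[U, o, b, a, T]) ω) ≤
    (∑ ω, weight w ω * ind (EJ[U, o, a, b, S ∩ T]) ω) *
      (∑ ω, weight w ω * ind (ES[U, o, a, b, S ∪ T]) ω) := by
  induction U using Finset.strongInduction with
  | H U ih =>
  intro o a b S T hSU hTU
  have hRHS : 0 ≤ (∑ ω, weight w ω * ind (EJ[U, o, a, b, S ∩ T]) ω) *
      (∑ ω, weight w ω * ind (ES[U, o, a, b, S ∪ T]) ω) :=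
    mul_nonneg (sepCapture_sum_nonneg hw0 hw1 _) (sepCapture_sum_nonneg hw0 hw1 _)
  -- trivial cases: a terminal lies in `S` (resp. `T`), then the first (resp. second) event is empty
  have hempty : ∀ (x y z : V) (W : Set V), (x ∈ W ∨ y ∈ W ∨ z ∈ W) →
      ∑ ω, weight w ω * ind (E1[U, x, y, z, W]) ω = 0 := by
    intro x y z W hW
    refine Finset.sum_eq_zero fun ω _ => ?_
    have hω : ω ∉ E1[U, x, y, z, W] := by
      rintro ⟨-, ⟨⟨h1, h2⟩, h3⟩⟩
      rcases hW with h | h | h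
      · exact (rD_eq_empty (U := U) (s := x) h).le h1
      · exact (rD_eq_empty (U := U) (s := y) h).le h2
      · exact (rD_eq_empty (U := U) (s := z) h).le h3
    rw [ind_of_not_mem hω, mul_zero]
  by_cases hS3 : o ∈ S ∨ a ∈ S ∨ b ∈ S
  · rw [hempty o a b S hS3, zero_mul]; exact hRHS
  by_cases hT3 : o ∈ T ∨ b ∈ T ∨ a ∈ T
  · rw [hempty o b a T hT3, mul_zero]; exact hRHS
  push Not at hS3 hT3
  obtain ⟨hoS, haS, hbS⟩ := hS3
  obtain ⟨hoT, hbT, haT⟩ := hT3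
  -- `Z := S ∩ T`
  set Z : Finset V := U.filter fun v => v ∈ S ∧ v ∈ T with hZ
  have hZU : Z ⊆ U := Finset.filter_subset _ _
  have hmemZ : ∀ v, v ∈ Z ↔ v ∈ S ∧ v ∈ T := fun v => by
    simp only [hZ, Finset.mem_filter, and_iff_right_iff_imp]
    exact fun h => hSU h.1
  have hoZ : o ∉ Z := fun h => hoS ((hmemZ o).1 h).1
  have haZ : a ∉ Z := fun h => haS ((hmemZ a).1 h).1
  have hbZ : b ∉ Z := fun h => hbS ((hmemZ b).1 h).1
  rcases Z.eq_empty_or_nonempty with hZe | hZne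
  · /- `S ∩ T = ∅`: the Ahlswede–Daykin four functions theorem on the configuration lattice
    (`{o↔a}`, `{o↔b}` up-sets; the separation events down-sets). -/
    have hST : ∀ v, v ∈ S ∩ T → False := fun v hv => by
      have : v ∈ Z := (hmemZ v).2 hv
      rw [hZe] at this
      exact Finset.notMem_empty v this
    have key := four_functions_theorem_univ
      (fun ω => weight w ω * ind (E1[U, o, a, b, S]) ω)
      (fun ω => weight w ω * ind (E1[U, o, b, a, T]) ω)
      (fun ω => weight w ω * ind (ES[U, o, a, b, S ∪ T]) ω)
      (fun ω => weight w ω * ind (EJ[U, o, a, b, S ∩ T]) ω)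
      (fun ω => mul_nonneg (weight_nonneg hw0 hw1 ω) (ind_nonneg _ _))
      (fun ω => mul_nonneg (weight_nonneg hw0 hw1 ω) (ind_nonneg _ _))
      (fun ω => mul_nonneg (weight_nonneg hw0 hw1 ω) (ind_nonneg _ _))
      (fun ω => mul_nonneg (weight_nonneg hw0 hw1 ω) (ind_nonneg _ _))
      (fun α β => ?_)
    · rw [mul_comm (∑ ω, weight w ω * ind (EJ[U, o, a, b, S ∩ T]) ω)]
      exact key
    -- the Ahlswede–Daykin hypothesis
    by_cases hα : α ∈ E1[U, o, a, b, S]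
    · by_cases hβ : β ∈ E1[U, o, b, a, T]
      · obtain ⟨⟨⟨hoa, hob⟩, hab⟩, ⟨⟨hoS', haS'⟩, hbS'⟩⟩ := hα
        obtain ⟨⟨⟨hob2, hoa2⟩, hba2⟩, ⟨⟨hoT', hbT'⟩, haT'⟩⟩ := hβ
        have hmeet : α ⊓ β ∈ ES[U, o, a, b, S ∪ T] := by
          refine ⟨⟨⟨fun h => hoa2 (h.mono (openGraph_le (Set.inter_subset_inter_left _
              Set.inter_subset_right))),
            fun h => hob (h.mono (openGraph_le (Set.inter_subset_inter_left _
              Set.inter_subset_left)))⟩,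
            fun h => hab (h.mono (openGraph_le (Set.inter_subset_inter_left _
              Set.inter_subset_left)))⟩, ?_⟩
          refine ⟨⟨?_, ?_⟩, ?_⟩
          · rw [rD_union]
            exact ⟨rD_decreasing Set.inter_subset_left hoS', rD_decreasing Set.inter_subset_right hoT'⟩
          · rw [rD_union]
            exact ⟨rD_decreasing Set.inter_subset_left haS', rD_decreasing Set.inter_subset_right haT'⟩
          · rw [rD_union]
            exact ⟨rD_decreasing Set.inter_subset_left hbS', rD_decreasing Set.inter_subset_right hbT'⟩
        have hjoin : α ⊔ β ∈ EJ[U, o, a, b, S ∩ T] := by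
          refine ⟨⟨hoa.mono (openGraph_le (Set.inter_subset_inter_left _ Set.subset_union_left)),
            hob2.mono (openGraph_le (Set.inter_subset_inter_left _ Set.subset_union_right))⟩, ?_⟩
          exact ⟨⟨fun v hv _ => hST v hv, fun v hv _ => hST v hv⟩, fun v hv _ => hST v hv⟩
        have e1 : ind (E1[U, o, a, b, S]) α = 1 := ind_of_mem ⟨⟨⟨hoa, hob⟩, hab⟩, ⟨⟨hoS', haS'⟩, hbS'⟩⟩
        have e2 : ind (E1[U, o, b, a, T]) β = 1 :=
          ind_of_mem ⟨⟨⟨hob2, hoa2⟩, hba2⟩, ⟨⟨hoT', hbT'⟩, haT'⟩⟩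
        rw [e1, e2, ind_of_mem hmeet, ind_of_mem hjoin, mul_one, mul_one, mul_one, mul_one]
        exact (weight_inter_mul_union w α β).le
      · rw [ind_of_not_mem hβ, mul_zero, mul_zero]
        exact mul_nonneg (mul_nonneg (weight_nonneg hw0 hw1 _) (ind_nonneg _ _))
          (mul_nonneg (weight_nonneg hw0 hw1 _) (ind_nonneg _ _))
    · rw [ind_of_not_mem hα, mul_zero, zero_mul]
      exact mul_nonneg (mul_nonneg (weight_nonneg hw0 hw1 _) (ind_nonneg _ _))
        (mul_nonneg (weight_nonneg hw0 hw1 _) (ind_nonneg _ _))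
  · /- `Z ≠ ∅`: condition on `S(ω)` and apply the four functions theorem with the induction
    hypothesis on `U ∖ Z`. -/
    have hss : U \ Z ⊂ U := Finset.sdiff_ssubset hZU hZne
    have hZS : (↑Z : Set V) ⊆ S := fun v hv => ((hmemZ v).1 hv).1
    have hZT : (↑Z : Set V) ⊆ T := fun v hv => ((hmemZ v).1 hv).2
    have hZST : (↑Z : Set V) ⊆ S ∩ T := fun v hv => (hmemZ v).1 hv
    have hZSuT : (↑Z : Set V) ⊆ S ∪ T := fun v hv => Or.inl ((hmemZ v).1 hv).1
    -- the four sums, conditioned on `S(ω)`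
    have e1 := sepCapture_step_sum w hm (E1[U, o, a, b, S]) (fun W => E1[U \ Z, o, a, b, W]) (S \ ↑Z)
      (fun R ω => sepCapture_E1_diff_meeting U Z o a b _ ω)
      (fun ω => sepCapture_E1_iff hZU hoZ haZ hbZ hZS ω)
    have e2 := sepCapture_step_sum w hm (E1[U, o, b, a, T]) (fun W => E1[U \ Z, o, b, a, W]) (T \ ↑Z)
      (fun R ω => sepCapture_E1_diff_meeting U Z o b a _ ω)
      (fun ω => sepCapture_E1_iff hZU hoZ hbZ haZ hZT ω)
    have e3 := sepCapture_step_sum w hm (EJ[U, o, a, b, S ∩ T]) (fun W => EJ[U \ Z, o, a, b, W])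
      ((S ∩ T) \ ↑Z)
      (fun R ω => sepCapture_EJ_diff_meeting U Z o a b _ ω)
      (fun ω => sepCapture_EJ_iff hZU hoZ haZ hbZ hZST ω)
    have e4 := sepCapture_step_sum w hm (ES[U, o, a, b, S ∪ T]) (fun W => ES[U \ Z, o, a, b, W])
      ((S ∪ T) \ ↑Z)
      (fun R ω => sepCapture_ES_diff_meeting U Z o a b _ ω)
      (fun ω => sepCapture_ES_iff hZU hoZ haZ hbZ hZSuT ω)
    rw [e1, e2, e3, e4]
    refine four_functions_theorem_univ
      (fun ω => weight w ω * ∑ η, weight w η * ind (E1[U \ Z, o, a, b, S \ ↑Z ∪ rS U Z ω]) η)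
      (fun ω => weight w ω * ∑ η, weight w η * ind (E1[U \ Z, o, b, a, T \ ↑Z ∪ rS U Z ω]) η)
      (fun ω => weight w ω * ∑ η, weight w η * ind (EJ[U \ Z, o, a, b, (S ∩ T) \ ↑Z ∪ rS U Z ω]) η)
      (fun ω => weight w ω * ∑ η, weight w η * ind (ES[U \ Z, o, a, b, (S ∪ T) \ ↑Z ∪ rS U Z ω]) η)
      (fun ω => mul_nonneg (weight_nonneg hw0 hw1 ω) (sepCapture_sum_nonneg hw0 hw1 _))
      (fun ω => mul_nonneg (weight_nonneg hw0 hw1 ω) (sepCapture_sum_nonneg hw0 hw1 _))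
      (fun ω => mul_nonneg (weight_nonneg hw0 hw1 ω) (sepCapture_sum_nonneg hw0 hw1 _))
      (fun ω => mul_nonneg (weight_nonneg hw0 hw1 ω) (sepCapture_sum_nonneg hw0 hw1 _))
      fun α β => ?_
    -- the Ahlswede–Daykin hypothesis: weight lattice identity × induction hypothesis
    set Ra := rS U Z α with hRa
    set Rb := rS U Z β with hRb
    have hRaU : Ra ⊆ ↑(U \ Z) := rS_subset U Z α
    have hRbU : Rb ⊆ ↑(U \ Z) := rS_subset U Z β
    have hS1 : S \ ↑Z ∪ Ra ⊆ ↑(U \ Z) := Set.union_subset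
      (fun v hv => by rw [Finset.coe_sdiff]; exact ⟨hSU hv.1, hv.2⟩) hRaU
    have hT1 : T \ ↑Z ∪ Rb ⊆ ↑(U \ Z) := Set.union_subset
      (fun v hv => by rw [Finset.coe_sdiff]; exact ⟨hTU hv.1, hv.2⟩) hRbU
    have IH := ih (U \ Z) hss o a b (S \ ↑Z ∪ Ra) (T \ ↑Z ∪ Rb) hS1 hT1
    have hsub3 : (S ∩ T) \ ↑Z ∪ rS U Z (α ∩ β) ⊆ (S \ ↑Z ∪ Ra) ∩ (T \ ↑Z ∪ Rb) := by
      refine Set.union_subset (fun v hv => ⟨Or.inl ⟨hv.1.1, hv.2⟩, Or.inl ⟨hv.1.2, hv.2⟩⟩) ?_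
      exact fun v hv =>
        ⟨Or.inr (rS_inter_subset U Z α β hv).1, Or.inr (rS_inter_subset U Z α β hv).2⟩
    have hsub4 : (S ∪ T) \ ↑Z ∪ rS U Z (α ∪ β) ⊆ (S \ ↑Z ∪ Ra) ∪ (T \ ↑Z ∪ Rb) := by
      rw [rS_union]
      rintro v (⟨hv | hv, hvZ⟩ | hv | hv)
      · exact Or.inl (Or.inl ⟨hv, hvZ⟩)
      · exact Or.inr (Or.inl ⟨hv, hvZ⟩)
      · exact Or.inl (Or.inr hv)
      · exact Or.inr (Or.inr hv)
    have h3 : ∑ η, weight w η * ind (EJ[U \ Z, o, a, b, (S \ ↑Z ∪ Ra) ∩ (T \ ↑Z ∪ Rb)]) η ≤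
        ∑ η, weight w η * ind (EJ[U \ Z, o, a, b, (S ∩ T) \ ↑Z ∪ rS U Z (α ∩ β)]) η :=
      sepCapture_sum_mono hw0 hw1 (Set.inter_subset_inter_right _
        (sepCapture_av_antitone (U \ Z) o a b hsub3))
    have h4 : ∑ η, weight w η * ind (ES[U \ Z, o, a, b, (S \ ↑Z ∪ Ra) ∪ (T \ ↑Z ∪ Rb)]) η ≤
        ∑ η, weight w η * ind (ES[U \ Z, o, a, b, (S ∪ T) \ ↑Z ∪ rS U Z (α ∪ β)]) η :=
      sepCapture_sum_mono hw0 hw1 (Set.inter_subset_inter_right _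
        (sepCapture_av_antitone (U \ Z) o a b hsub4))
    have hIH' : (∑ η, weight w η * ind (E1[U \ Z, o, a, b, S \ ↑Z ∪ Ra]) η) *
        (∑ η, weight w η * ind (E1[U \ Z, o, b, a, T \ ↑Z ∪ Rb]) η) ≤
        (∑ η, weight w η * ind (EJ[U \ Z, o, a, b, (S ∩ T) \ ↑Z ∪ rS U Z (α ∩ β)]) η) *
          (∑ η, weight w η * ind (ES[U \ Z, o, a, b, (S ∪ T) \ ↑Z ∪ rS U Z (α ∪ β)]) η) :=
      IH.trans (mul_le_mul h3 h4 (sepCapture_sum_nonneg hw0 hw1 _) (sepCapture_sum_nonneg hw0 hw1 _))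
    have hwab := weight_inter_mul_union w α β
    show weight w α * (∑ η, weight w η * ind (E1[U \ Z, o, a, b, S \ ↑Z ∪ Ra]) η) *
        (weight w β * ∑ η, weight w η * ind (E1[U \ Z, o, b, a, T \ ↑Z ∪ Rb]) η) ≤
      weight w (α ∩ β) *
          (∑ η, weight w η * ind (EJ[U \ Z, o, a, b, (S ∩ T) \ ↑Z ∪ rS U Z (α ∩ β)]) η) *
        (weight w (α ∪ β) *
          ∑ η, weight w η * ind (ES[U \ Z, o, a, b, (S ∪ T) \ ↑Z ∪ rS U Z (α ∪ β)]) η)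
    calc weight w α * (∑ η, weight w η * ind (E1[U \ Z, o, a, b, S \ ↑Z ∪ Ra]) η) *
          (weight w β * ∑ η, weight w η * ind (E1[U \ Z, o, b, a, T \ ↑Z ∪ Rb]) η)
        = (weight w α * weight w β) *
          ((∑ η, weight w η * ind (E1[U \ Z, o, a, b, S \ ↑Z ∪ Ra]) η) *
            ∑ η, weight w η * ind (E1[U \ Z, o, b, a, T \ ↑Z ∪ Rb]) η) := by ring
      _ ≤ (weight w (α ∩ β) * weight w (α ∪ β)) *
          ((∑ η, weight w η * ind (EJ[U \ Z, o, a, b, (S ∩ T) \ ↑Z ∪ rS U Z (α ∩ β)]) η) *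
            ∑ η, weight w η * ind (ES[U \ Z, o, a, b, (S ∪ T) \ ↑Z ∪ rS U Z (α ∪ β)]) η) := by
          rw [hwab]
          exact mul_le_mul_of_nonneg_left hIH'
            (mul_nonneg (weight_nonneg hw0 hw1 _) (weight_nonneg hw0 hw1 _))
      _ = _ := by ring

end Events

/-! ### Measure statements (`U = univ`) -/

section Measure

variable [Fintype V]

/-- **Separated capture with two avoidance sets.**  For vertices `o, a, b`, vertex sets `S, T` and
`μ = prodBernoulli w`:
`μ(o↔a, o↮b, a↮b, {o,a,b}↮S) · μ(o↔b, o↮a, b↮a, {o,b,a}↮T)`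
`  ≤ μ(o↔a, o↔b, {o,a,b}↮(S∩T)) · μ(o↮a, o↮b, a↮b, {o,a,b}↮(S∪T))`,
where `{o,a,b}↮W` is written `{∀ x ∈ W, o↮x} ∩ {∀ x ∈ W, a↮x} ∩ {∀ x ∈ W, b↮x}`.
[cite: VandenbergKahn2001, Thm. 1.2 (pp. 124–126) — method; derived in this file] -/
theorem sepCapture_two_sets (w : Sym2 V → unitInterval) (o a b : V) (S T : Set V) :
    (prodBernoulli w).real (openConn o a ∩ (openConn o b)ᶜ ∩ (openConn a b)ᶜ ∩
        ({ω | ∀ x ∈ S, ω ∉ openConn o x} ∩ {ω | ∀ x ∈ S, ω ∉ openConn a x} ∩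
          {ω | ∀ x ∈ S, ω ∉ openConn b x})) *
      (prodBernoulli w).real (openConn o b ∩ (openConn o a)ᶜ ∩ (openConn b a)ᶜ ∩
        ({ω | ∀ x ∈ T, ω ∉ openConn o x} ∩ {ω | ∀ x ∈ T, ω ∉ openConn b x} ∩
          {ω | ∀ x ∈ T, ω ∉ openConn a x})) ≤
    (prodBernoulli w).real (openConn o a ∩ openConn o b ∩
        ({ω | ∀ x ∈ S ∩ T, ω ∉ openConn o x} ∩ {ω | ∀ x ∈ S ∩ T, ω ∉ openConn a x} ∩
          {ω | ∀ x ∈ S ∩ T, ω ∉ openConn b x})) *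
      (prodBernoulli w).real ((openConn o a)ᶜ ∩ (openConn o b)ᶜ ∩ (openConn a b)ᶜ ∩
        ({ω | ∀ x ∈ S ∪ T, ω ∉ openConn o x} ∩ {ω | ∀ x ∈ S ∪ T, ω ∉ openConn a x} ∩
          {ω | ∀ x ∈ S ∪ T, ω ∉ openConn b x})) := by
  set w' : Sym2 V → ℝ := fun e => (w e : ℝ) with hw'
  have hw0 : ∀ e, 0 ≤ w' e := fun e => (w e).2.1
  have hw1 : ∀ e, w' e ≤ 1 := fun e => (w e).2.2
  have hm : ∑ ω, weight w' ω = 1 := by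
    have h1 := integral_prodBernoulli_eq_sum w fun _ => (1 : ℝ)
    simp only [integral_const, probReal_univ, smul_eq_mul, mul_one] at h1
    exact h1.symm
  have hE : ∀ ω : Set (Sym2 V), ω ∩ edgesIn (Finset.univ : Finset V) = ω := fun ω => by
    ext e
    simp only [Set.mem_inter_iff, edgesIn, Set.mem_setOf_eq, Finset.mem_univ, imp_true_iff, and_true]
  have hR : ∀ x y : V, rR[(Finset.univ : Finset V), x, y] = openConn x y := fun x y => by
    ext ω; simp only [Set.mem_setOf_eq, hE]; rfl
  have hDD : ∀ (s : V) (Z : Set V),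
      rD (Finset.univ : Finset V) s Z = {ω : BondConfig V | ∀ x ∈ Z, ω ∉ openConn s x} := by
    intro s Z; ext ω; simp only [rD, hE, Set.mem_setOf_eq]; rfl
  have key := sepCapture_core w' hw0 hw1 hm Finset.univ o a b S T (by simp) (by simp)
  simp only [hR, hDD] at key
  rw [TwoAvoidanceSets.real_eq_sum_ind, TwoAvoidanceSets.real_eq_sum_ind,
    TwoAvoidanceSets.real_eq_sum_ind, TwoAvoidanceSets.real_eq_sum_ind]
  exact key

/-- **(V1) the four-point separated-capture inequality.**  For vertices `o, a, b, c`: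
`P(oa|b|c) · P(ob|a|c) ≤ P(oab|c) · P(o|a|b|c)`, i.e.
`μ(o↔a, o↮b, a↮b, o↮c, a↮c, b↮c) · μ(o↔b, o↮a, b↮a, o↮c, b↮c, a↮c)`
`  ≤ μ(o↔a, o↔b, o↮c, a↮c, b↮c) · μ(o↮a, o↮b, a↮b, o↮c, a↮c, b↮c)` — the captured-set inequality
`capturedSet_mul_le` with the third relay kept isolated on both sides.
[cite: VandenbergKahn2001, Thm. 1.2 (pp. 124–126) — method; derived in this file] -/
theorem sepCapture_three (w : Sym2 V → unitInterval) (o a b c : V) :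
    (prodBernoulli w).real (openConn o a ∩ (openConn o b)ᶜ ∩ (openConn a b)ᶜ ∩
        ((openConn o c)ᶜ ∩ (openConn a c)ᶜ ∩ (openConn b c)ᶜ)) *
      (prodBernoulli w).real (openConn o b ∩ (openConn o a)ᶜ ∩ (openConn b a)ᶜ ∩
        ((openConn o c)ᶜ ∩ (openConn b c)ᶜ ∩ (openConn a c)ᶜ)) ≤
    (prodBernoulli w).real (openConn o a ∩ openConn o b ∩
        ((openConn o c)ᶜ ∩ (openConn a c)ᶜ ∩ (openConn b c)ᶜ)) *
      (prodBernoulli w).real ((openConn o a)ᶜ ∩ (openConn o b)ᶜ ∩ (openConn a b)ᶜ ∩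
        ((openConn o c)ᶜ ∩ (openConn a c)ᶜ ∩ (openConn b c)ᶜ)) := by
  have key := sepCapture_two_sets w o a b {c} {c}
  have h1 : ∀ s : V, {ω : BondConfig V | ∀ x ∈ ({c} : Set V), ω ∉ openConn s x} = (openConn s c)ᶜ := by
    intro s; ext ω; simp only [Set.mem_setOf_eq, Set.mem_singleton_iff, forall_eq, Set.mem_compl_iff]
  simp only [Set.inter_self, Set.union_self, h1] at key
  exact key

end Measure

end Summit.CriticalPhenomena.PercolationContinuityZ3.Theorems

end
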